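import Summits.AtomisticToContinuum.BoseEinsteinCondensation.Theses.BECCellInformation
import Literature.MathematicalPhysics.QuantumManyBody.BoseGasThermodynamicLimitRuelle

/-!
# Route `BECCellInformation`, support item `EnergyPerParticleBound` (stmt-AtomisticToContinuum-13442)

ENERGY PER PARTICLE BOUNDED at small density: for every repulsive finite-range pair potential `v`
(hard cores allowed) there is `ρ₀ > 0` such that for `0 < ρ < ρ₀` there is `K` with
`E₀^D(N, (N/ρ)^{1/3}) ≤ K · N` for all large `N`.

Proof: pick a range `R > 0` of `v` (`IsRepulsiveFiniteRange.exists_pos_range`) and put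
`ρ₀ := ((1 + R)³)⁻¹`. For `0 < ρ < ρ₀` one particle per unit cell fits, `ρ (1 + R)³ < 1`, so the
tree's Ruelle finiteness theorem `limsup_lt_top_of_small` (Ruelle 1969 §3.5.11 (F)) gives
`e⁺(ρ) = limsup_N E₀^D(N, L_N)/N < ⊤`; hence eventually `E₀^D(N, L_N)/N < e⁺(ρ) + 1`, i.e.
`E₀^D(N, L_N) ≤ K N` with `K := (e⁺(ρ) + 1).toReal`. No scattering-length case split is needed
(the sharper Dyson constant `4πρa(1 + C(ρa³)^{1/3})` of
`eventually_groundStateEnergy_le_dyson` is not used).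

References: D. Ruelle, *Statistical Mechanics: Rigorous Results* (1969), §3.5.11; LSSY 2005,
Thm. 2.2 (2.14) for the sharp constant (not used).
-/

noncomputable section

namespace Summit.AtomisticToContinuum.BoseEinsteinCondensation.Theorems

open Filter
open scoped ENNReal

/-- **`EnergyPerParticleBound` holds** (settles stmt-AtomisticToContinuum-13442, exact route decl):
for every repulsive finite-range `v` there is `ρ₀ > 0` with
`∀ ρ ∈ (0, ρ₀), ∃ K, ∀ᶠ N, groundStateEnergy v N (sideLength ρ N) ≤ ENNReal.ofReal (K * N)`.
From Ruelle's finiteness of the upper energy per particle below close packing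
(`limsup_lt_top_of_small`, Ruelle 1969 §3.5.11 (F)) with `ρ₀ := ((1 + R)³)⁻¹` for a range `R > 0`
of `v` and `K := (e⁺(ρ) + 1).toReal`. [folklore] -/
theorem energyPerParticleBound_proof :
    Summit.AtomisticToContinuum.BoseEinsteinCondensation.Theses.BECCellInformation.EnergyPerParticleBound := by
  unfold Summit.AtomisticToContinuum.BoseEinsteinCondensation.Theses.BECCellInformation.EnergyPerParticleBound
  intro v hv
  obtain ⟨R, hR, hv0⟩ := hv.exists_pos_range
  have h3 : 0 < (1 + R) ^ 3 := by positivity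
  refine ⟨((1 + R) ^ 3)⁻¹, inv_pos.2 h3, fun ρ hρ hρlt => ?_⟩
  have hsmall : ρ * (1 + R) ^ 3 < 1 := by
    have := mul_lt_mul_of_pos_right hρlt h3
    rwa [inv_mul_cancel₀ h3.ne'] at this
  have hfin :
      Literature.MathematicalPhysics.QuantumManyBody.BoseGas.limsupEnergyPerParticle v ρ < ⊤ :=
    Literature.MathematicalPhysics.QuantumManyBody.BoseGas.limsup_lt_top_of_small hv.1 hv0 hR hρ
      hsmall
  set e := Literature.MathematicalPhysics.QuantumManyBody.BoseGas.limsupEnergyPerParticle v ρ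
    with he
  have he1 : e + 1 ≠ ⊤ := ENNReal.add_ne_top.2 ⟨hfin.ne, ENNReal.one_ne_top⟩
  refine ⟨(e + 1).toReal, ?_⟩
  have hlt :
      limsup (Literature.MathematicalPhysics.QuantumManyBody.BoseGas.energyPerParticleDirichlet v ρ)
        atTop < e + 1 :=
    ENNReal.lt_add_right hfin.ne one_ne_zero
  filter_upwards [Filter.eventually_lt_of_limsup_lt hlt, eventually_gt_atTop 0] with N hN hN0
  have hN0' : (N : ℝ≥0∞) ≠ 0 := Nat.cast_ne_zero.2 (Nat.pos_iff_ne_zero.1 hN0)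
  have hNtop : (N : ℝ≥0∞) ≠ ⊤ := ENNReal.natCast_ne_top N
  have hN' :
      Literature.MathematicalPhysics.QuantumManyBody.BoseGas.groundStateEnergy v N
          (Literature.MathematicalPhysics.QuantumManyBody.BoseGas.sideLength ρ N) <
        (e + 1) * N := by
    rw [← ENNReal.div_lt_iff (Or.inl hN0') (Or.inl hNtop)]
    exact hN
  rw [ENNReal.ofReal_mul ENNReal.toReal_nonneg, ENNReal.ofReal_toReal he1, ENNReal.ofReal_natCast]
  exact hN'.le

end Summit.AtomisticToContinuum.BoseEinsteinCondensation.Theorems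

end
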